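import Mathlib
import Summits.ValiantsHypothesis.ValiantsHypothesis.Theses.UlrichPadded
import Literature.Computability.AlgebraicComplexity.PermanentIrreducible
import Literature.Computability.AlgebraicComplexity.VonZurGathenSingPermHeight
import Literature.LinearAlgebra.Matrix.PermanentSubperm

/-!
# Line `nagata-corner-subpermanent` for crux `PermHypersurfaceFactorial` (stmt-ValiantsHypothesis-5666)

Crux (by name): `Summit.ValiantsHypothesis.ValiantsHypothesis.Theses.UlrichPadded.PermHypersurfaceFactorial`
(route `route-ValiantsHypothesis-UlrichPadded`, rank 2):

  `∀ n ≥ 3, ∀ P : Ideal (ℂ[x_ij] ⧸ (per_n)), P.IsPrime → P.height = 1 → P.IsPrincipal`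

("`S_n = ℂ[x]/(per_n)` is factorial"; for the noetherian domain `S_n` this is `Cl(S_n) = 0`).

Skeleton of idea card `Ideas/nagata-corner-subpermanent.md` (ideator k = 1; triage r1-1 / r1-2 / r1-3:
pass; merge group "Nagata at the corner cofactor" with `subpermanent-height-three-nagata` and
`cofactor-linear-type`).  GENERATION 2 (planner-cruxplan-stmt-ValiantsHypothesis-5666-nagata-corner-subper-g2-0,
2026-08-16) of the gen-1 skeleton (same five registered stubs, same names and statements, so every
gen-1 registration / evidence stays valid); what gen 2 adds is in-code: the explicit CHAIN WITNESS of
the hardest stub (`zeta`, `cornerWitness`, `cornerWitness_mem_span` — sorry-free) and a complete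
two-case proof plan for H3(n) in the idiom of `VonZurGathenSingPermHeight.lean` (docstring of
`stub_rowSubpermHeightThree`), the exact tree lemma that discharges the unmixedness stub
(`Literature.Barriers.Schanuel.Transfer.minimalPrimes_of_mem_associatedPrimes_of_le`), and the
leading-coefficient route for the linear-form stub.  Panel sharpenings kept from gen 1: (a) every
per-specific statement is over `ℂ`; (b) the Cohen–Macaulay / unmixedness step is its OWN general stub;
(c) the linear-form primality lemma is filed in its two-coefficient form (Fossum 1973 Lemma 14.1
pattern), which is exactly what a regular sequence `P₀, P₁, P₂` feeds — no grade / depth API anywhere.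

THE LINE.  Row-`0` Laplace expansion `per_n = Σ_j x_{0j} P_j`, `P_j = ∂per_n/∂x_{0j} = per x(0|j)`
(tree `VonZurGathen.pderiv_perPoly`), `P_j ∈ B := ℂ[rows ≥ 1]`.
* `stub_awayCornerUFD` (M): `S_n[1/P̄₀] ≅ ℂ[x ∖ x₀₀][1/P₀]` (solve `x₀₀ = −(Σ_{j≥1} x_{0j}P_j)/P₀`) is a
  localisation of a polynomial UFD, hence a UFD.
* `stub_rowSubpermHeightThree` (L, HARDEST, the load-bearing lemma H3(n)): every prime of `ℂ[x]`
  containing `P₀, P₁, P₂` has height `≥ 3` (`n ≥ 3`; false at `n = 2`, for `det`, and in characteristic 2).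
  Gen-2 plan: generic point `a` of `Q`; CASE A — some `ζ_i = ∂P₀/∂x_{i1} = per(rows ∉ {0,i}, cols ≥ 2)`
  is nonzero at `a`: the chain `⊥ < Q_{x_{i0},x_{i1}} < Q_{x_{i0}} < Q` with witnesses `P₁`, `P₀` and the
  explicit polynomial `cornerWitness = ζ_i·P₂ − (∂P₂/∂x_{i0})·P₁ − (∂P₂/∂x_{i1})·P₀ ∈ (P₀,P₁,P₂)`, which is
  free of `x_{i0}, x_{i1}` and NONZERO (value `−(n−2)!(n−1)!` at the all-ones matrix; kit j007697);
  CASE B — all `ζ_i(a) = 0`: the maximal subpermanents of the `(n−1) × (n−2)` block (rows ≥ 1, cols ≥ 2)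
  vanish at `a`, i.e. (transpose) the instance of size `n − 1` of the same statement — induction, with
  the explicit base `n = 3`.
* `stub_homogeneousRegularThree` (M): Macaulay unmixedness for three FORMS of positive degree in a
  polynomial ring over a field: if every prime over `(f₁, f₂, f₃)` has height `≥ 3` then `f₁, f₂, f₃` is a
  regular sequence (stated as explicit non-zero-divisor conditions).  Homogeneity is necessary
  (`(xz, yz, z − 1)` in `K[x,y,z]`).
* `stub_linearFormPrime` (M): over a domain `D`, a linear form `Σ_j a_j y_j` with `a_{j₁} ≠ 0` and `a_{j₂}`
  regular modulo `a_{j₁}` generates a prime ideal of `D[y]`.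
* `stub_cornerPrimeTransfer` (M–L, the per-specific plumbing = the card's Transfer `C⁺ = CornerSectionPrime`):
  given the linear-form lemma and the regular sequence `P₀, P₁, P₂`, the class of `P₀` is a PRIME ELEMENT of
  `S_n`: `ℂ[x]/(per_n, P₀) = ℂ[x]/(P₀, Q) ≅ D[x₀₀, …, x₀,ₙ₋₁]/(Σ_{j} P̄_j x_{0j})` with `D = B/(P₀)` a domain
  (`P₀` is the permanent of an `(n−1) × (n−1)` generic matrix, `perPoly_irreducible`), `P̄₀ = 0`, `P̄₁ ≠ 0`,
  `P̄₂` regular mod `P̄₁`.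
* `PermHypersurfaceFactorial_of`: H3 + unmixedness ⇒ `P₀, P₁, P₂` regular ⇒ (transfer + linear form) `P̄₀`
  prime ⇒ (Nagata, Mathlib `UniqueFactorizationMonoid.iff_localizationAway_of_prime`, with the UFD chart)
  `S_n` is a UFD ⇒ (`UniqueFactorizationMonoid.isPrincipal_of_height_eq_one`) the crux, BY NAME; the
  composition `permHypersurfaceFactorial_of_parts` is sorry-free.

Disproof.lean (cdisprove gen-2 v7, verdict "crux RESISTS") honoured:
`permHypersurfaceFactorial_false_without_three_le` — `3 ≤ n` is carried by every per-specific stub and is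
USED at `stub_rowSubpermHeightThree` (third column; `rowPartialsHeightThree_false_at_two`: H(2), the
two-column analogue, is false — H3 cannot even be stated below `n = 3`) and at `stub_cornerPrimeTransfer`
(`cofactor_not_prime_two`: `x̄₁₁ ∣ x̄₀₁x̄₁₀` in `S_2`);
`permHypersurfaceFactorial_false_without_heightOne` — the composition proves `UniqueFactorizationMonoid S_n`
and converts ONLY height-one primes (`isPrincipal_of_height_eq_one`); `span_per_cofactor_not_isPrime_three_charTwo`
— everything per-specific is over `ℂ` (the Case-A witness is certified nonzero by its value `−(n−2)!(n−1)!`,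
a characteristic-zero certificate; in characteristic 2 already `n = 3` gives `−2·x₁₁x₂₀x₁₂ = 0`);
`det_cofactor_not_prime_three` — the determinant fails exactly at H3 (maximal minors of an `(n−1) × n`
matrix have height 2).  No `Theorems/PermHypersurfaceFactorial/Negative/` lemma has landed (nothing to
import, checked 2026-08-16); `ledger negatives --problem ValiantsHypothesis` (5668, 0340, 3735, 3738) has
nothing on factoriality / heights / primality — no stub restates a refuted statement.
-/

noncomputable section

namespace Summit.ValiantsHypothesis.ValiantsHypothesis.Cruxes.PermHypersurfaceFactorial.NagataCornerSubpermanent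

open MvPolynomial Literature.Computability.AlgebraicComplexity

set_option linter.unusedVariables false
set_option linter.dupNamespace false

/-! ## Objects of the line -/

/-- The polynomial ring `ℂ[x_ij]`, `i, j < n`. -/
abbrev PolyRing (n : ℕ) : Type := MvPolynomial (Fin n × Fin n) ℂ

/-- The principal ideal `(per_n)`. -/
abbrev perIdeal (n : ℕ) : Ideal (PolyRing n) := Ideal.span {perPoly (Fin n) ℂ}

/-- The permanental hypersurface ring `S_n = ℂ[x_ij]/(per_n)` (literally the ring of the crux). -/
abbrev PerRing (n : ℕ) : Type := PolyRing n ⧸ perIdeal n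

/-- The first-row subpermanent `P_j = ∂ per_n / ∂ x_{0j} = per x(0|j)` (tree
`VonZurGathen.pderiv_perPoly`: the subpermanent of the generic matrix deleting row `0` and column `j`;
it lies in `ℂ[rows ≥ 1]` and is homogeneous of degree `n − 1`). -/
def rowSubperm (n : ℕ) (hn : 3 ≤ n) (j : Fin n) : PolyRing n :=
  pderiv ((⟨0, by omega⟩ : Fin n), j) (perPoly (Fin n) ℂ)

/-- `P₀ = per x(0|0)`, the corner subpermanent (the Nagata denominator of the line). -/
abbrev P₀ (n : ℕ) (hn : 3 ≤ n) : PolyRing n := rowSubperm n hn ⟨0, by omega⟩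

/-- `P₁ = per x(0|1)`. -/
abbrev P₁ (n : ℕ) (hn : 3 ≤ n) : PolyRing n := rowSubperm n hn ⟨1, by omega⟩

/-- `P₂ = per x(0|2)` — the third column is where `3 ≤ n` is consumed. -/
abbrev P₂ (n : ℕ) (hn : 3 ≤ n) : PolyRing n := rowSubperm n hn ⟨2, by omega⟩

/-- Read-back: `P_j` is the subpermanent of the generic matrix on the columns `≠ j` and the rows `≠ 0`
(tree `VonZurGathen.pderiv_perPoly`), i.e. `per x(0|j)` — the entry point to the tree's subpermanent
toolkit (`Matrix.subperm_expand_row`, `VonZurGathen.subperm_insert_row`, `subperm_X_ne_zero`, …). -/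
theorem rowSubperm_eq_subperm (n : ℕ) (hn : 3 ≤ n) (j : Fin n) :
    rowSubperm n hn j =
      (Matrix.mvPolynomialX (Fin n) (Fin n) ℂ).subperm (· ≠ j) (· ≠ ((⟨0, by omega⟩ : Fin n))) := by
  rw [rowSubperm, VonZurGathen.pderiv_perPoly]

/-- Read-back: the row-`0` Laplace expansion `per_n = Σ_j x_{0j} · P_j` behind stubs A and E
(`Matrix.subperm_expand_row` at row `0`). -/
theorem perPoly_eq_rowExpansion (n : ℕ) (hn : 3 ≤ n) :
    perPoly (Fin n) ℂ = ∑ j : Fin n, X (((⟨0, by omega⟩ : Fin n)), j) * rowSubperm n hn j := by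
  classical
  have h := (Matrix.mvPolynomialX (Fin n) (Fin n) ℂ).subperm_expand_row
    (p := fun _ => True) (q := fun _ => True) ((⟨0, by omega⟩ : Fin n)) trivial
  rw [Matrix.subperm_true, Finset.filter_true] at h
  have hper : perPoly (Fin n) ℂ = (Matrix.mvPolynomialX (Fin n) (Fin n) ℂ).permanent := rfl
  rw [hper, h]
  refine Finset.sum_congr rfl fun j _ => ?_
  rw [Matrix.mvPolynomialX_apply, rowSubperm, VonZurGathen.pderiv_perPoly]
  congr 1
  exact (Matrix.mvPolynomialX (Fin n) (Fin n) ℂ).subperm_congr (fun _ => by simp) (fun _ => by simp)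

/-- `P_j` is a form of degree `n − 1` (`perPoly_isHomogeneous` + Mathlib `IsHomogeneous.pderiv`). -/
theorem rowSubperm_isHomogeneous (n : ℕ) (hn : 3 ≤ n) (j : Fin n) :
    (rowSubperm n hn j).IsHomogeneous (n - 1) := by
  have h := (perPoly_isHomogeneous (n := Fin n) (k := ℂ)).pderiv (i := (((⟨0, by omega⟩ : Fin n)), j))
  simpa [rowSubperm] using h

instance (n : ℕ) : IsNoetherianRing (PerRing n) := by
  unfold PerRing; infer_instance

/-- `S_n` is a domain for `n ≥ 1` (tree `perPoly_irreducible` + Gauss). -/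
theorem isDomain_perRing (n : ℕ) (hn : 3 ≤ n) : IsDomain (PerRing n) := by
  haveI : Nonempty (Fin n) := ⟨⟨0, by omega⟩⟩
  have hirr : Irreducible (perPoly (Fin n) ℂ) := perPoly_irreducible
  have hprime : Prime (perPoly (Fin n) ℂ) := hirr.prime
  have : (perIdeal n).IsPrime := (Ideal.span_singleton_prime hprime.ne_zero).mpr hprime
  exact Ideal.Quotient.isDomain _

/-! ## The chain witness of the hardest stub (gen 2; sorry-free bookkeeping)

For a row `i` of the block (any `i : Fin n`; only `i ≠ 0` is used) put
`ζ_i := ∂P₀/∂x_{i1}` (`= ∂P₁/∂x_{i0} = per(rows ∉ {0,i}, cols ≥ 2)`, a maximal subpermanent of the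
`(n−1) × (n−2)` block `Z = (rows ≥ 1) × (cols ≥ 2)`), and
`w_i := ζ_i · P₂ − (∂P₂/∂x_{i0}) · P₁ − (∂P₂/∂x_{i1}) · P₀`.
With `u = column 0`, `v = column 1`, `z = column 2` of the block and `H = H(cols ≥ 3)` the symmetric
zero-diagonal matrix of `(n−3)`-subpermanents, the three first-row subpermanents are the three pairings
`P₁ = uᵀζ`, `P₀ = vᵀζ`, `ζ = Hz`, `P₂ = uᵀHv` of `u, v, z` under `H`.  Expanding along row `i`,
`P₁ = x_{i0}ζ_i + R₁`, `P₀ = x_{i1}ζ_i + R₀`, `P₂ = x_{i0}A + x_{i1}B′ + R₂` (`A = ∂P₂/∂x_{i0}`,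
`B′ = ∂P₂/∂x_{i1}`; `R₀, R₁, R₂` = the column-`≥ 2` resp. `≥ 3` parts of the row-`i` expansions), so
`w_i = ζ_i R₂ − A R₁ − B′ R₀` is manifestly FREE of `x_{i0}, x_{i1}` (the prover may take this as the
definition and read `cornerWitness_mem_span` as the identity); under `u = v = z = t` it specialises to
`−(Ht)_i · (tᵀHt) ≠ 0` (`char ≠ 2`), and at the all-ones matrix
`w_i = (n−2)!(n−1)! − 2(n−2)!(n−1)! = −(n−2)!(n−1)!` (kit j007697: n = 3, 4, 5 exact, every `i`; at
`n = 3`, `w₁ = −2·x₂₀x₂₁x₁₂`). -/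

/-- `ζ_i = ∂P₀/∂x_{i1}`: for `i ≠ 0` the maximal subpermanent of the block `(rows ≥ 1) × (cols ≥ 2)`
deleting row `i` (Case A / Case B of the plan split on whether some `ζ_i` survives at the generic point). -/
def zeta (n : ℕ) (hn : 3 ≤ n) (i : Fin n) : PolyRing n :=
  pderiv (i, (⟨1, by omega⟩ : Fin n)) (P₀ n hn)

/-- The Case-A chain witness `w_i = ζ_i·P₂ − (∂P₂/∂x_{i0})·P₁ − (∂P₂/∂x_{i1})·P₀`. -/
def cornerWitness (n : ℕ) (hn : 3 ≤ n) (i : Fin n) : PolyRing n :=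
  zeta n hn i * P₂ n hn
    - pderiv (i, (⟨0, by omega⟩ : Fin n)) (P₂ n hn) * P₁ n hn
    - pderiv (i, (⟨1, by omega⟩ : Fin n)) (P₂ n hn) * P₀ n hn

/-- `w_i ∈ (P₀, P₁, P₂)` — so `w_i` lies in every prime `Q ⊇ {P₀, P₁, P₂}` and, being free of
`x_{i0}, x_{i1}`, in the chain prime `Q_{x_{i0},x_{i1}}` (`VonZurGathen.subperm_piecewise_eq_C` pattern);
`w_i ≠ 0` then gives `⊥ < Q_{x_{i0},x_{i1}}` (`VonZurGathen.one_le_height_ker`). [folklore] -/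
theorem cornerWitness_mem_span (n : ℕ) (hn : 3 ≤ n) (i : Fin n) :
    cornerWitness n hn i ∈ Ideal.span ({P₀ n hn, P₁ n hn, P₂ n hn} : Set (PolyRing n)) := by
  have h0 : P₀ n hn ∈ Ideal.span ({P₀ n hn, P₁ n hn, P₂ n hn} : Set (PolyRing n)) :=
    Ideal.subset_span (by simp)
  have h1 : P₁ n hn ∈ Ideal.span ({P₀ n hn, P₁ n hn, P₂ n hn} : Set (PolyRing n)) :=
    Ideal.subset_span (by simp)
  have h2 : P₂ n hn ∈ Ideal.span ({P₀ n hn, P₁ n hn, P₂ n hn} : Set (PolyRing n)) :=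
    Ideal.subset_span (by simp)
  unfold cornerWitness
  exact Ideal.sub_mem _ (Ideal.sub_mem _ (Ideal.mul_mem_left _ _ h2) (Ideal.mul_mem_left _ _ h1))
    (Ideal.mul_mem_left _ _ h0)

/-! ## Statements of the stubs -/

/-- **Stub A statement (UFD chart).** `S_n[1/P̄₀]` is a UFD (`n ≥ 3`): by the row-`0` expansion
`per_n = x₀₀·P₀ + Q` with `P₀, Q` free of `x₀₀`, the map `ℂ[x ∖ x₀₀][1/P₀] → S_n[1/P̄₀]`,
`x₀₀ ↦ −Q/P₀`, is an isomorphism onto a localisation of a polynomial UFD. -/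
def AwayCornerUFD : Prop :=
  ∀ (n : ℕ) (hn : 3 ≤ n),
    UniqueFactorizationMonoid (Localization.Away (Ideal.Quotient.mk (perIdeal n) (P₀ n hn)))

/-- **Stub B statement — H3(n), the load-bearing height count.** For `n ≥ 3` every prime of `ℂ[x_ij]`
containing the three first-row subpermanents `P₀, P₁, P₂` has height `≥ 3` (equivalently: the maximal
subpermanents through columns `0, 1, 2` of a generic `(n−1) × n` matrix cut out codimension 3 — the extra
row's variables are free).  False at `n = 2` (Disproof `rowPartialsHeightThree_false_at_two`), for the
determinant (height 2: `Cl(det) = ℤ`) and in characteristic 2.  H3(n) ⇒ H(n) (all `n` first-row partials,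
the sibling line's `stub_rowPartialsHeightThree`) trivially. -/
def RowSubpermHeightThree : Prop :=
  ∀ (n : ℕ) (hn : 3 ≤ n) (Q : Ideal (PolyRing n)), Q.IsPrime →
    P₀ n hn ∈ Q → P₁ n hn ∈ Q → P₂ n hn ∈ Q → (3 : ℕ∞) ≤ Q.height

/-- **Stub C statement — unmixedness for three forms (Macaulay).** In a polynomial ring in finitely many
variables over a field, three homogeneous polynomials of positive degree such that every prime containing
them has height `≥ 3` form a regular sequence: `f₁ ≠ 0`, `f₂` is a non-zero-divisor modulo `(f₁)`, and
`f₃` is a non-zero-divisor modulo `(f₁, f₂)`.  (Homogeneity cannot be dropped: `xz, yz, z − 1`.) -/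
def HomogeneousRegularThree : Prop :=
  ∀ (K : Type) [Field K] (σ : Type) [Fintype σ] (f₁ f₂ f₃ : MvPolynomial σ K) (d₁ d₂ d₃ : ℕ),
    f₁.IsHomogeneous d₁ → f₂.IsHomogeneous d₂ → f₃.IsHomogeneous d₃ → d₁ ≠ 0 → d₂ ≠ 0 → d₃ ≠ 0 →
    (∀ Q : Ideal (MvPolynomial σ K), Q.IsPrime → f₁ ∈ Q → f₂ ∈ Q → f₃ ∈ Q → (3 : ℕ∞) ≤ Q.height) →
    f₁ ≠ 0 ∧
      (∀ g : MvPolynomial σ K, f₂ * g ∈ Ideal.span {f₁} → g ∈ Ideal.span {f₁}) ∧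
      (∀ g : MvPolynomial σ K, f₃ * g ∈ Ideal.span {f₁, f₂} → g ∈ Ideal.span {f₁, f₂})

/-- **Stub D statement — primality of a linear form (Fossum 1973, Lemma 14.1 pattern).** Over an integral
domain `D`, a linear form `L = Σ_j a_j y_j ∈ D[y_j : j ∈ ι]` one of whose coefficients `a_{j₁}` is nonzero
and another of whose coefficients `a_{j₂}` is a non-zero-divisor modulo `a_{j₁}` generates a prime ideal.
(Proof: `a_{j₁}` is regular on `D[y]/(L)` by a leading-coefficient argument modulo `a_{j₁}`, and
`D[y]/(L)[1/a_{j₁}] ≅ D[1/a_{j₁}][y_j : j ≠ j₁]` is a domain.) -/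
def LinearFormPrime : Prop :=
  ∀ (D : Type) [CommRing D] [IsDomain D] (ι : Type) [Fintype ι] (a : ι → D) (j₁ j₂ : ι),
    j₁ ≠ j₂ → a j₁ ≠ 0 →
    (∀ z : D, a j₂ * z ∈ Ideal.span {a j₁} → z ∈ Ideal.span {a j₁}) →
    (Ideal.span ({∑ j : ι, C (a j) * X j} : Set (MvPolynomial ι D))).IsPrime

/-- The regular-sequence property of `P₀, P₁, P₂` in `ℂ[x_ij]` at one `n` (the instance of stub C fed by
stub B; this is the card's `RowSubpermRegular`). -/
def RowSubpermRegularAt (n : ℕ) (hn : 3 ≤ n) : Prop :=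
  P₀ n hn ≠ 0 ∧
    (∀ g : PolyRing n, P₁ n hn * g ∈ Ideal.span {P₀ n hn} → g ∈ Ideal.span {P₀ n hn}) ∧
    (∀ g : PolyRing n, P₂ n hn * g ∈ Ideal.span {P₀ n hn, P₁ n hn} → g ∈ Ideal.span {P₀ n hn, P₁ n hn})

/-- **Stub E statement — the corner transfer (`C⁺ = CornerSectionPrime` of the card).** Given the
linear-form lemma and the regular sequence `P₀, P₁, P₂`, the class of the corner subpermanent `P₀` is a
PRIME ELEMENT of `S_n` (`n ≥ 3`), i.e. `(per_n, P₀) = (P₀, Σ_{j≥1} x_{0j}P_j)` is a prime ideal of `ℂ[x]`: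
identify `ℂ[x]/(P₀, Q)` with `D[x₀₀, …, x₀,ₙ₋₁]/(Σ_j P̄_j x_{0j})`, `D = ℂ[rows ≥ 1]/(P₀)` a domain
(`perPoly_irreducible` for the `(n−1) × (n−1)` generic matrix, renamed), coefficients `P̄₀ = 0`,
`P̄₁ ≠ 0`, `P̄₂` regular mod `P̄₁` (from `RowSubpermRegularAt`, restricted to `ℂ[rows ≥ 1]` by killing the
row-`0` variables).  False at `n = 2` (Disproof `cofactor_not_prime_two`). -/
def CornerPrimeTransfer : Prop :=
  LinearFormPrime → ∀ (n : ℕ) (hn : 3 ≤ n), RowSubpermRegularAt n hn →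
    Prime (Ideal.Quotient.mk (perIdeal n) (P₀ n hn))

/-! ## Registered stubs -/

/-- **Stub A — UFD chart (size M).** `S_n[1/P̄₀]` is a localised polynomial ring, hence a UFD.  Why true:
`per_n = x₀₀ P₀ + Q` (row expansion, `perPoly_eq_rowExpansion`) with `P₀ ≠ 0` and `P₀, Q ∈ ℂ[x ∖ x₀₀]`;
in `ℂ[x ∖ x₀₀][1/P₀][x₀₀]` the element `per_n = P₀(x₀₀ + Q/P₀)` is a unit times a variable shift, so the
quotient is `ℂ[x ∖ x₀₀][1/P₀]`, a localisation of a UFD (Mathlib `UniqueFactorizationMonoid` instance for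
`MvPolynomial`, `UniqueFactorizationMonoid.of_isLocalization`), and `UniqueFactorizationMonoid` transports
along the ring isomorphism (`MulEquiv.uniqueFactorizationMonoid`).  Tools: `MvPolynomial.optionEquivLeft` /
`sumAlgEquiv` / `renameEquiv` to single out `x₀₀`; `IsLocalization.Away` API; localisation commutes with
quotients (`Ideal.quotientMap` / `IsLocalization.algEquiv`).  Shared verbatim (same `pderiv` term) with the
sibling line's `stub_awayMinorUFD` (`Lines/subpermanent-height-three-nagata.lean`) and with
`IdeatorSketch2.AwayMinorUFD`: one proof serves all. -/
theorem stub_awayCornerUFD : AwayCornerUFD := by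
  sorry

/-- **Stub B — H3(n) (size L; HARDEST; the load-bearing lemma).**  RECOMMENDED PLAN (gen 2, chain idiom of
`vonzurGathen1987_singPerm_height_holds`; no dimension theory).  Let `Q ⊇ {P₀,P₁,P₂}` be prime,
`L = ℂ[x]/Q`, `a = (x mod Q) : Fin n × Fin n → L` its generic point, so `Q = ker (aeval a)`
(`VonZurGathen.ker_aeval_piecewise_empty` normal form); chains `Q_T = ker (aeval a^T)` with
`a^T = T.piecewise X (C ∘ a)`; each strict step is `height_ker_aeval_piecewise_insert` with a witness
`r`, `r(a^T) = 0 ≠ r(a^{T ∪ x})`; sum up with `natCast_succ_le`.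
CASE A: `ζ_i(a) ≠ 0` for some `i ≠ 0` (`zeta`).  Step 1, free `x_{i0}`, witness `P₁`:
`P₁(a^{x_{i0}}) = (X_{i0} − a_{i0})·ζ_i(a)` (`P₁` is linear in `x_{i0}` with coefficient `ζ_i`, row
expansion `Matrix.subperm_expand_row` / `VonZurGathen.subperm_insert_row`; `X_mul_C_add_C_ne_zero`).
Step 2, free `x_{i1}`, witness `P₀`: `P₀` is free of column 0, so `P₀(a^{x_{i0}}) = 0`, and
`P₀(a^{x_{i0},x_{i1}}) = (X_{i1} − a_{i1})·ζ_i(a) ≠ 0`.  Step 3: `w_i = cornerWitness n hn i ∈ Q`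
(`cornerWitness_mem_span`) is free of `x_{i0}, x_{i1}`, hence `w_i(a^{x_{i0},x_{i1}}) = w_i(a) = 0`
(`subperm_piecewise_eq_C` pattern, or `MvPolynomial.eval₂` congruence on `vars`), and `w_i ≠ 0`
(evaluate at the all-ones matrix: `−(n−2)!(n−1)! ≠ 0` in `ℂ`; permanent of the all-ones `k × k` matrix
`= k!` by `Finset.sum_const`/`Fintype.card_perm`), so `⊥ < Q_{x_{i0},x_{i1}}` by `one_le_height_ker` —
total `3 ≤ height Q`.
CASE B: `ζ_i(a) = 0` for all `i ≠ 0`, i.e. all maximal subpermanents of the `(n−1) × (n−2)` block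
`Z = (rows ≥ 1) × (cols ≥ 2)` vanish at `a`.  `n = 3`: `Z` is the column `(x₁₂, x₂₂)`, so
`a₁₂ = a₂₂ = 0` and `P₂(a) = a₁₀a₂₁ + a₂₀a₁₁ = 0`; either all of `a₁₀,a₁₁,a₂₀,a₂₁` vanish (six vanishing
coordinates, `card_le_height_ker_aeval`) or, say, `a₂₁ ≠ 0`: free `x₁₂` (witness `X₁₂`), `x₂₂` (witness
`X₂₂`), then `x₁₀` (witness `P₂`, free of column 2: `P₂(a^{x₁₂,x₂₂,x₁₀}) = (X₁₀ − a₁₀)·a₂₁ ≠ 0`) — three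
steps; the other three sub-cases are symmetric.  `n ≥ 4`: by `Matrix.permanent_transpose` the vanishing
maximal subpermanents of `Z` are the "first-row subpermanents" of the TRANSPOSED block
`(cols ≥ 2) × (rows ≥ 1)` of size `(n−2) × (n−1)`, an instance of H3 at size `n − 1 ≥ 3` inside the same
ring — so prove the stub through the block form
`HB(m) : ∀ σ L (a : σ → L) (e : Fin (m−1) × Fin m ↪ σ), (the three maximal subpermanents of the e-block
deleting columns 0, 1, 2 vanish at a) → 3 ≤ height (ker (aeval a))` by induction on `m ≥ 3`
(Case A/B as above at every `m`; Case B at `m ≥ 4` is `HB(m−1)` with the transposed embedding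
`e′ (p, q) = e (q, p + 2)`), and specialise to `σ = Fin n × Fin n`, `e (p, q) = (p + 1, q)`,
`rowSubperm_eq_subperm` + `Matrix.subperm_eq_permanent_of_equiv`.  ALTERNATIVES (gen 1 / cards): the rank
stratification of the symmetric zero-diagonal matrix `Φ` of `(n−2)`-subpermanents (`2Φ₀₁Φ₀₂Φ₁₂` minor),
or r1-2's bundle argument (`V(P₀,P₁) ∖ {ζ = 0}` irreducible of codim 2, `P₂ ≢ 0` on it, `codim{ζ=0} ≥ 3`
by H(n−1)) — both need more infrastructure in Lean.  EVIDENCE: codim 3 by hand at n = 3 (five components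
of dim 3); Kirkup 2008 Prop. 11 (n = 4, `I₃(3,4)` radical CI); exact certificates j005903 (n ≤ 5, ℚ),
j007518 (n ≤ 7: 3-space cone sections zero-dimensional of degree `(n−1)³`, det controls not), H(n) n ≤ 7
(j004945); Case-A witness identities j007697 (n = 3, 4, 5). -/
theorem stub_rowSubpermHeightThree : RowSubpermHeightThree := by
  sorry

/-- **Stub C — unmixedness of three forms (size M).**  Why true / plan: let `𝔪 = (X_i)` (every form of
positive degree lies in `𝔪`; for `σ` empty the hypothesis is contradictory).  (1) `f₁ ≠ 0`: otherwise a
minimal prime of `(f₂, f₃) ⊆ 𝔪` has height `≤ 2` (Krull, `Ideal.height_le_spanFinrank`) and contains all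
three.  (2) `f₂ ∉ (p)` for every prime factor `p ∣ f₁` (a factor of a form is a form, so `(p, f₃) ⊆ 𝔪` is
proper and a minimal prime over it has height `≤ 2` and contains `f₁, f₂, f₃`); hence `f₂` is regular mod
`f₁` (UFD `K[σ]`: `f₁ ∣ f₂g` and no prime factor of `f₁` divides `f₂` ⇒ `f₁ ∣ g`).  (3) `f₃` regular mod
`(f₁, f₂)`: if not, `f₃` lies in an associated prime `P` of `K[σ]/(f₁,f₂)`
(`biUnion_associatedPrimes_eq_compl_nonZeroDivisors` / `biUnion_associatedPrimes_eq_zero_divisors`,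
Noetherian); the tree's unmixedness-at-a-prime theorem for regular rings
`Literature.Barriers.Schanuel.Transfer.minimalPrimes_of_mem_associatedPrimes_of_le`
(NesterenkoModularScopeProp36Unmixed.lean; `[IsRegularRing R]`, Mathlib instance for `MvPolynomial` over a
field via `Mathlib.RingTheory.RegularLocalRing.Polynomial`; `Es = [f₁, f₂]`, `𝔭 := P`, avoidance
hypothesis = (1) + (2), `Ideal.ofList [f₁,f₂] = span {f₁,f₂}`, `mem_associatedPrimes_quotient_iff`) makes
`P` a minimal prime of `(f₁, f₂)` of height 2 — contradicting the hypothesis since `f₁, f₂, f₃ ∈ P`.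
Counterexample without homogeneity: `(xz, yz, z−1)`. [cite: Matsumura1987, Thm. 17.6] -/
theorem stub_homogeneousRegularThree : HomogeneousRegularThree := by
  sorry

/-- **Stub D — linear forms with a regular pair of coefficients are prime (size M, pure Mathlib).**  Plan:
`T := D[y]/(L)`, `L = Σ a_j y_j`.  (1) `a_{j₁}` is a non-zero-divisor on `T`: if `a_{j₁} g = L h` then,
modulo `a_{j₁}`, `L̄ h̄ = 0` in `(D/a_{j₁})[y]`, where `L̄ = Σ_{j ≠ j₁} ā_j y_j` has `y_{j₂}`-leading
coefficient `ā_{j₂}`, a non-zero-divisor of `D/a_{j₁}` by hypothesis, so `L̄` is a non-zero-divisor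
(`Polynomial.mem_nonZeroDivisors_of_leadingCoeff` after `MvPolynomial.optionEquivLeft`/`finSuccEquiv`-type
isolation of `y_{j₂}`, or McCoy `Polynomial.notMem_nonZeroDivisors_iff`), hence `h = a_{j₁} h′` and
`g = L h′` (`D[y]` is a domain).  (2) `T[1/a_{j₁}] ≅ D[1/a_{j₁}][y_j : j ≠ j₁]` (`L = a_{j₁}·(y_{j₁} + …)`,
unit times a variable shift) is a domain, and `T ↪ T[1/a_{j₁}]` by (1) (`IsLocalization.injective`), so
`T` is a domain, i.e. `(L)` is prime (`Ideal.Quotient.isDomain_iff_prime`; `(L) ≠ ⊤` as `L` has no constant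
term).  No noetherian hypothesis needed. [cite: Fossum1973, Lemma 14.1] -/
theorem stub_linearFormPrime : LinearFormPrime := by
  sorry

/-- **Stub E — the corner transfer (size M–L, plumbing).** Why true: see the statement's docstring; the
ring identifications are `MvPolynomial.sumAlgEquiv` / `renameEquiv` (split `Fin n × Fin n` into row `0`
and rows `≥ 1`), `Ideal.quotientEquiv`, `DoubleQuot.quotQuotEquivQuotSup`, and `per_n = Σ_j X(0,j) · P_j`
(`perPoly_eq_rowExpansion`), so `(per_n, P₀) = (P₀, Σ_{j≥1} X(0,j)·P_j)`; `P₀` is `rename` of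
`perPoly (Fin (n−1)) ℂ`, irreducible (`perPoly_irreducible`, `n − 1 ≥ 2`), prime in the UFD `ℂ[rows ≥ 1]`;
`P̄₁ ≠ 0` because `P₁ ∈ (P₀)` would give `1 ∈ (P₀)` by regularity; `P̄₂` regular mod `P̄₁` in
`ℂ[rows ≥ 1]/(P₀)` by lifting to `ℂ[x]`, `RowSubpermRegularAt`, and killing the row-`0` variables
(`aeval` retraction fixing every `P_j`, cf. Disproof.lean `killVars`); apply `LinearFormPrime` with
`ι = Fin n`, `a_j = P̄_j` (`a₀ = 0`), `j₁ = 1`, `j₂ = 2`; transport back: `S_n/(P̄₀) ≅ ℂ[x]/(per_n, P₀)`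
is a domain and `P̄₀ ≠ 0` (`deg P₀ = n − 1 < n`, or `P₀ ∉ (per_n)` by irreducibility), so `Prime P̄₀`
(`Ideal.Quotient.isDomain_iff_prime`, `Ideal.span_singleton_prime`). -/
theorem stub_cornerPrimeTransfer : CornerPrimeTransfer := by
  sorry

/-! ## Kernel-checked composition -/

/-- **Composition of the line (sorry-free).** UFD chart + H3 + unmixedness + linear-form primality +
corner transfer ⇒ every height-one prime of `S_n` is principal (`n ≥ 3`): Nagata's criterion (Mathlib
`UniqueFactorizationMonoid.iff_localizationAway_of_prime`) at the prime element `P̄₀`, then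
`UniqueFactorizationMonoid.isPrincipal_of_height_eq_one`.  The conclusion is the crux unfolded (so that
exactly one theorem of this file, `PermHypersurfaceFactorial_of`, concludes the crux by name). -/
theorem permHypersurfaceFactorial_of_parts (hA : AwayCornerUFD) (hB : RowSubpermHeightThree)
    (hC : HomogeneousRegularThree) (hD : LinearFormPrime) (hE : CornerPrimeTransfer) :
    ∀ n : ℕ, 3 ≤ n → ∀ P : Ideal (PerRing n), P.IsPrime → P.height = 1 → P.IsPrincipal := by
  intro n hn P hP h1
  haveI : IsDomain (PerRing n) := isDomain_perRing n hn
  haveI := hP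
  have hreg : RowSubpermRegularAt n hn :=
    hC ℂ (Fin n × Fin n) (P₀ n hn) (P₁ n hn) (P₂ n hn) (n - 1) (n - 1) (n - 1)
      (rowSubperm_isHomogeneous n hn _) (rowSubperm_isHomogeneous n hn _)
      (rowSubperm_isHomogeneous n hn _) (by omega) (by omega) (by omega) (hB n hn)
  have hprime : Prime (Ideal.Quotient.mk (perIdeal n) (P₀ n hn)) := hE hD n hn hreg
  haveI : UniqueFactorizationMonoid (PerRing n) :=
    (UniqueFactorizationMonoid.iff_localizationAway_of_prime hprime).mpr (hA n hn)
  exact UniqueFactorizationMonoid.isPrincipal_of_height_eq_one h1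

/-- **The skeleton concludes the crux BY NAME**: `UlrichPadded.PermHypersurfaceFactorial`
(stmt-ValiantsHypothesis-5666) from the five registered stubs. -/
theorem PermHypersurfaceFactorial_of :
    Summit.ValiantsHypothesis.ValiantsHypothesis.Theses.UlrichPadded.PermHypersurfaceFactorial :=
  permHypersurfaceFactorial_of_parts stub_awayCornerUFD stub_rowSubpermHeightThree
    stub_homogeneousRegularThree stub_linearFormPrime stub_cornerPrimeTransfer

end Summit.ValiantsHypothesis.ValiantsHypothesis.Cruxes.PermHypersurfaceFactorial.NagataCornerSubpermanent

end
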